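import Summits.Ventures.YMGap.YM3IR.ForestAudit

/-!
# YM3IR / ForestHaar — the forest marginal of every Wilson law IS product Haar (kernel proof)

HONEST FRAMING.  This file proves a piece of FOLKLORE (the tree / axial gauge on a loop-free set of links:
Montvay–Münster, *Quantum Fields on a Lattice* §3.2.5 (3.131)–(3.133); Creutz, *Quarks, Gluons and Lattices*
eq. (9.19)) in the typed setting of this cell's track Y4, and NOTHING about Yang–Mills dynamics: no mass gap, no
continuum statement, no claim on any conjecture-labelled item except that it DISCHARGES the folklore-labelled
hypothesis `ForestMarginalHaar` of `YM3IR/ForestAudit.lean` (ym3ir-theory-2 g4's strength audit of `IRConjecture3`).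

CONTENT.  For the star-decimation block map `starDecimation b M : GaugeConfig 3 (b·M) G → GaugeConfig 3 M G`
(`(y,i) ↦ U(b·y, i)`) with `2 ≤ b`, a compact second-countable group `G` and a continuous representation `ρ`:
`(wilsonMeasure ρ β on the torus of side b·M).map (starDecimation b M) = Measure.pi (fun _ => haarProbability G)`
for EVERY `β` (`map_starDecimation_wilsonMeasure_eq_pi`).  Mechanism, entirely in the tree's language: the LEAF GAUGE
ROTATION `leafGauge g` (value `g(y,i)⁻¹` at the leaf `b·y + eᵢ` of each star link, `1` elsewhere) satisfies
`starDecimation ∘ gaugeTransform (leafGauge g) = (· * g) ∘ starDecimation` (`starDecimation_gaugeTransform_leafGauge`;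
this is where `2 ≤ b` enters: leaves are not centres and belong to one star link each), so gauge invariance of the
Wilson law (`wilsonMeasure_map_gaugeTransform_holds`, Wilson 1974) makes the push-forward RIGHT-invariant under the
whole compact group `G^{E(M)}`; a right-invariant probability measure on a compact second-countable group is unique
(`eq_of_isMulRightInvariant_of_isProbabilityMeasure`, via `μ.inv` and Mathlib's `haarMeasure_unique`), and the product
of normalised Haar measures is one.  COROLLARIES: `forestMarginalHaar_of_two_le` (the audit's named folklore fact),
`entersClusterDomain_forestFamily_of_two_le` and `su2_entersClusterDomain_forestFamily` — CLAUSE (a)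
(`EntersClusterDomain`) OF THE §Y4 SENTENCE'S ONE CONJECTURE `IRConjecture3` HOLDS FOR THE FOREST FAMILY with any block
factor `2 ≤ b(β) ≤ C_b β`, at every `β`, with `β' = 0`, `W' = 0`, using no dynamics.  This is the kernel form of the
audit's finding F1(a): clause (a) alone carries no infrared content for a free measurable block family (theory-1 g5,
md §15, independently; the forest MAP is not gauge-covariant in Bałaban's sense B7 (11) — covariance of the map is the
dividing property, see theory-1's `IRConjecture3Cov` proposal).  Clause (b) for the forest family (= the fine theory's own
clustering, audit §2.3–2.6, `ForestWitness3`) is NOT proved here.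

References: I. Montvay, G. Münster, *Quantum Fields on a Lattice* (CUP 1994) §3.2.5; M. Creutz, *Quarks, Gluons and
Lattices* (CUP 1983) eq. (9.19); K. Wilson, Phys. Rev. D 10 (1974) 2445 §III.B [cite: Wilson1974]; cell files
ym3ir/AUDIT-theory2-g4.md §2.2, ym3ir/YM3-IR-theory2.md §9.
-/

/-! ## 3. The forest marginal IS product Haar — kernel proof of the folklore tree-gauge lemma -/

noncomputable section

open MeasureTheory ProbabilityTheory
open Literature.MathematicalPhysics.QuantumLattice Literature.MathematicalPhysics.QuantumFieldTheory

namespace Summit.Ventures.YMGap.YM3IR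

section HaarUniqueness

variable {K : Type*} [Group K] [TopologicalSpace K] [IsTopologicalGroup K] [CompactSpace K]
  [MeasurableSpace K] [BorelSpace K] [SecondCountableTopology K]

/-- On a compact second-countable group, two RIGHT-invariant probability measures coincide (both are the
normalised Haar measure: `μ.inv` is left-invariant, and left-invariant measures are unique,
Mathlib `haarMeasure_unique`). [folklore] -/
theorem eq_of_isMulRightInvariant_of_isProbabilityMeasure (μ ν : Measure K) [IsProbabilityMeasure μ]
    [IsProbabilityMeasure ν] [μ.IsMulRightInvariant] [ν.IsMulRightInvariant] : μ = ν := by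
  have key : ∀ (μ : Measure K) [IsProbabilityMeasure μ] [μ.IsMulRightInvariant],
      μ.inv = Measure.haarMeasure (⊤ : TopologicalSpace.PositiveCompacts K) := by
    intro μ _ _
    haveI : IsProbabilityMeasure μ.inv :=
      ⟨by rw [Measure.inv_apply, Set.inv_univ, measure_univ]⟩
    have h := Measure.haarMeasure_unique μ.inv (⊤ : TopologicalSpace.PositiveCompacts K)
    rw [TopologicalSpace.PositiveCompacts.coe_top, measure_univ, one_smul] at h
    exact h
  rw [← Measure.inv_inv μ, key μ, ← key ν, Measure.inv_inv]

end HaarUniqueness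

section ForestHaar

variable {G : Type} [MeasurableSpace G] {N : ℕ} [Group G] [TopologicalSpace G] [IsTopologicalGroup G]
  [CompactSpace G] [BorelSpace G]

/-- The LEAF GAUGE TRANSFORMATION attached to a coarse group element `g : Edge 3 M → G`: `g(y,i)⁻¹` at the
leaf `b·y + eᵢ` of the star link `(b·y, i)` — the site whose `i`-th coordinate is `≡ 1 (mod b)` and whose other
coordinates are `≡ 0 (mod b)` (canonical representatives) — and the identity at every other site. [folklore] -/
def leafGauge (b M : ℕ) (g : Edge 3 M → G) (x : Site 3 (b * M)) : G := by
  classical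
  exact if h : ∃ i : Fin 3, (x i).val % b = 1 ∧ ∀ j, j ≠ i → (x j).val % b = 0
    then (g (blockOf b M x, h.choose))⁻¹ else 1

variable {b M : ℕ} [NeZero M]

omit [MeasurableSpace G] [Group G] [TopologicalSpace G] [IsTopologicalGroup G] [CompactSpace G]
  [BorelSpace G] in
/-- Canonical representative of a lifted coordinate: `(b·y)_j = b · y_j`. [folklore] -/
theorem liftSite_val (hb : 0 < b) (y : Site 3 M) (j : Fin 3) :
    (liftSite b M y j).val = b * (y j).val := by
  simp only [liftSite, ZMod.val_natCast]
  apply Nat.mod_eq_of_lt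
  have := ZMod.val_lt (y j)
  nlinarith

omit [MeasurableSpace G] [Group G] [TopologicalSpace G] [IsTopologicalGroup G] [CompactSpace G]
  [BorelSpace G] in
/-- Canonical representative of the leaf's `i`-th coordinate: `(b·y + eᵢ)_i = b · y_i + 1` (needs `2 ≤ b`). [folklore] -/
theorem liftSite_shift_val_self (hb : 2 ≤ b) (y : Site 3 M) (i : Fin 3) :
    (((liftSite b M y).shift i) i).val = b * (y i).val + 1 := by
  have hcast : ((liftSite b M y).shift i) i = ((b * (y i).val + 1 : ℕ) : ZMod (b * M)) := by
    simp [Site.shift, liftSite]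
  rw [hcast, ZMod.val_natCast]
  apply Nat.mod_eq_of_lt
  have := ZMod.val_lt (y i)
  nlinarith

omit [MeasurableSpace G] [Group G] [TopologicalSpace G] [IsTopologicalGroup G] [CompactSpace G]
  [BorelSpace G] in
/-- The leaf's other coordinates are those of the centre: `(b·y + eᵢ)_j = b · y_j` for `j ≠ i`. [folklore] -/
theorem liftSite_shift_val_ne (hb : 0 < b) (y : Site 3 M) {i j : Fin 3} (hj : j ≠ i) :
    (((liftSite b M y).shift i) j).val = b * (y j).val := by
  have : ((liftSite b M y).shift i) j = liftSite b M y j := by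
    simp [Site.shift, hj]
  rw [this, liftSite_val hb]

omit [MeasurableSpace G] [Group G] [TopologicalSpace G] [IsTopologicalGroup G] [CompactSpace G]
  [BorelSpace G] in
/-- A centre `b·y` is not a leaf (its coordinates are `≡ 0`, not `≡ 1`, mod `b ≥ 2`). [folklore] -/
theorem not_isLeaf_liftSite (hb : 2 ≤ b) (y : Site 3 M) (i : Fin 3) :
    ¬ ((liftSite b M y i).val % b = 1 ∧ ∀ j, j ≠ i → (liftSite b M y j).val % b = 0) := by
  intro h
  have h1 := h.1
  rw [liftSite_val (by omega) y i, Nat.mul_mod_right] at h1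
  exact absurd h1 (by norm_num)

omit [MeasurableSpace G] [Group G] [TopologicalSpace G] [IsTopologicalGroup G] [CompactSpace G]
  [BorelSpace G] in
/-- `b·y + eᵢ` is a leaf in direction `i`. [folklore] -/
theorem isLeaf_shift (hb : 2 ≤ b) (y : Site 3 M) (i : Fin 3) :
    (((liftSite b M y).shift i) i).val % b = 1 ∧ ∀ j, j ≠ i → (((liftSite b M y).shift i) j).val % b = 0 := by
  refine ⟨?_, fun j hj => ?_⟩
  · rw [liftSite_shift_val_self hb]
    have : (b * (y i).val + 1) % b = 1 % b := by
      rw [Nat.add_comm, Nat.add_mul_mod_self_left]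
    rw [this]
    exact Nat.mod_eq_of_lt (by omega)
  · rw [liftSite_shift_val_ne (by omega) y hj, Nat.mul_mod_right]

omit [MeasurableSpace G] [Group G] [TopologicalSpace G] [IsTopologicalGroup G] [CompactSpace G]
  [BorelSpace G] in
/-- … and in no other direction. [folklore] -/
theorem isLeaf_shift_unique (hb : 2 ≤ b) (y : Site 3 M) {i i' : Fin 3}
    (h : (((liftSite b M y).shift i) i').val % b = 1 ∧ ∀ j, j ≠ i' → (((liftSite b M y).shift i) j).val % b = 0) :
    i' = i := by
  by_contra hne
  have h1 := h.1
  rw [liftSite_shift_val_ne (by omega) y hne, Nat.mul_mod_right] at h1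
  exact absurd h1 (by norm_num)

omit [MeasurableSpace G] [Group G] [TopologicalSpace G] [IsTopologicalGroup G] [CompactSpace G]
  [BorelSpace G] in
/-- The block of the leaf `b·y + eᵢ` is `y`. [folklore] -/
theorem blockOf_liftSite_shift (hb : 2 ≤ b) (y : Site 3 M) (i : Fin 3) :
    blockOf b M ((liftSite b M y).shift i) = y := by
  funext j
  simp only [blockOf]
  by_cases hj : j = i
  · subst hj
    rw [liftSite_shift_val_self hb, Nat.mul_add_div (by omega), Nat.div_eq_of_lt (by omega : 1 < b),
      add_zero, ZMod.natCast_zmod_val]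
  · rw [liftSite_shift_val_ne (by omega) y hj, Nat.mul_div_cancel_left _ (by omega : 0 < b),
      ZMod.natCast_zmod_val]

omit [MeasurableSpace G] [TopologicalSpace G] [IsTopologicalGroup G] [CompactSpace G] [BorelSpace G] in
/-- The leaf gauge transformation is the identity at every centre. [folklore] -/
theorem leafGauge_liftSite (hb : 2 ≤ b) (g : Edge 3 M → G) (y : Site 3 M) :
    leafGauge b M g (liftSite b M y) = 1 := by
  classical
  unfold leafGauge
  rw [dif_neg]
  rintro ⟨i, hi⟩
  exact not_isLeaf_liftSite hb y i hi

omit [MeasurableSpace G] [TopologicalSpace G] [IsTopologicalGroup G] [CompactSpace G] [BorelSpace G] in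
/-- The leaf gauge transformation at the leaf of the star link `(b·y, i)` is `g(y,i)⁻¹`. [folklore] -/
theorem leafGauge_shift (hb : 2 ≤ b) (g : Edge 3 M → G) (y : Site 3 M) (i : Fin 3) :
    leafGauge b M g ((liftSite b M y).shift i) = (g (y, i))⁻¹ := by
  classical
  have hex : ∃ i' : Fin 3, (((liftSite b M y).shift i) i').val % b = 1 ∧
      ∀ j, j ≠ i' → (((liftSite b M y).shift i) j).val % b = 0 := ⟨i, isLeaf_shift hb y i⟩
  unfold leafGauge
  rw [dif_pos hex, blockOf_liftSite_shift hb, isLeaf_shift_unique hb y hex.choose_spec]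

omit [MeasurableSpace G] [TopologicalSpace G] [IsTopologicalGroup G] [CompactSpace G] [BorelSpace G] in
/-- **Transitivity of leaf gauge rotations on the star links**: gauge-transforming by `leafGauge g` and then
decimating = decimating and then multiplying on the RIGHT by `g`, link by link. [folklore] -/
theorem starDecimation_gaugeTransform_leafGauge (hb : 2 ≤ b) (g : Edge 3 M → G)
    (U : GaugeConfig 3 (b * M) G) :
    starDecimation b M (gaugeTransform (leafGauge b M g) U) = starDecimation b M U * g := by
  funext e
  obtain ⟨y, i⟩ := e
  simp only [starDecimation_apply, Pi.mul_apply, gaugeTransform, leafGauge_liftSite hb,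
    leafGauge_shift hb, one_mul, inv_inv]

/-- **Right-invariance of the forest marginal**: the push-forward of the Wilson law under star decimation is
invariant under right multiplication by every coarse group element (gauge invariance of the Wilson law,
`wilsonMeasure_map_gaugeTransform_holds`, composed with the leaf gauge rotation). [folklore] -/
theorem map_mulRight_map_starDecimation_wilsonMeasure (ρ : G →* Matrix (Fin N) (Fin N) ℂ) (hb : 2 ≤ b)
    [NeZero (b * M)] (β : ℝ) (g : Edge 3 M → G) :
    ((wilsonMeasure (d := 3) (L := b * M) ρ β).map (starDecimation b M)).map (· * g)
      = (wilsonMeasure (d := 3) (L := b * M) ρ β).map (starDecimation b M) := by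
  have hmul : Measurable (fun V : GaugeConfig 3 M G => V * g) :=
    measurable_pi_lambda _ (fun e => by
      have h1 : Measurable (fun V : GaugeConfig 3 M G => V e) := measurable_pi_apply e
      simpa only [Pi.mul_apply] using h1.mul_const (g e))
  have hsd := measurable_starDecimation (G := G) b M
  have hγ : Measurable (gaugeTransform (leafGauge b M g) : GaugeConfig 3 (b * M) G → _) :=
    (WilsonGauge.measurePreserving_gaugeTransform (d := 3) (L := b * M) (leafGauge b M g)).measurable
  have hcomp : (fun V : GaugeConfig 3 M G => V * g) ∘ starDecimation b M
      = starDecimation b M ∘ gaugeTransform (leafGauge b M g) := by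
    funext U
    simp only [Function.comp_apply, starDecimation_gaugeTransform_leafGauge hb]
  have hinv : (wilsonMeasure (d := 3) (L := b * M) ρ β).map (gaugeTransform (leafGauge b M g))
      = wilsonMeasure (d := 3) (L := b * M) ρ β :=
    wilsonMeasure_map_gaugeTransform_holds (d := 3) (L := b * M) (ρ := ρ) β (leafGauge b M g)
  rw [Measure.map_map hmul hsd, hcomp, ← Measure.map_map hsd hγ, hinv]

/-- **THE FOREST MARGINAL IS PRODUCT HAAR** (tree gauge on a forest; Montvay–Münster §3.2.5 (3.131)–(3.133),
Creutz (9.19)): for `2 ≤ b`, continuous `ρ` and every `β`, the push-forward of the Wilson law on the torus of side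
`b·M` under star decimation is the product of normalised Haar measures on the coarse links — a right-invariant
probability measure on the compact group `G^{E(M)}`, hence THE Haar probability measure
(`eq_of_isMulRightInvariant_of_isProbabilityMeasure`). [folklore] -/
theorem map_starDecimation_wilsonMeasure_eq_pi [SecondCountableTopology G]
    (ρ : G →* Matrix (Fin N) (Fin N) ℂ) (hρ : Continuous ρ) (hb : 2 ≤ b) [NeZero (b * M)] (β : ℝ) :
    (wilsonMeasure (d := 3) (L := b * M) ρ β).map (starDecimation b M)
      = Measure.pi fun _ : Edge 3 M => haarProbability G := by
  haveI := isProbabilityMeasure_wilsonMeasure (d := 3) (L := b * M) (G := G) ρ hρ β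
  haveI : IsProbabilityMeasure ((wilsonMeasure (d := 3) (L := b * M) ρ β).map (starDecimation b M)) :=
    Measure.isProbabilityMeasure_map (measurable_starDecimation b M).aemeasurable
  haveI : ((wilsonMeasure (d := 3) (L := b * M) ρ β).map (starDecimation b M)).IsMulRightInvariant :=
    ⟨fun g => map_mulRight_map_starDecimation_wilsonMeasure ρ hb β g⟩
  exact eq_of_isMulRightInvariant_of_isProbabilityMeasure _ _

/-- **`ForestMarginalHaar` DISCHARGED** for block factors `≥ 2` and continuous `ρ`. [folklore] -/
theorem forestMarginalHaar_of_two_le [SecondCountableTopology G] (ρ : G →* Matrix (Fin N) (Fin N) ℂ)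
    (hρ : Continuous ρ) {bf : ℝ → ℕ} (hbf : ∀ β, 0 < bf β) {I : Set ℝ} (h2 : ∀ β ∈ I, 2 ≤ bf β) :
    ForestMarginalHaar ρ bf hbf I := by
  intro β hβ M _ _
  haveI : NeZero (bf β * M) := BlockFamily.neZero_mul (G := G) (forestFamily bf hbf) β M
  show (wilsonMeasure (d := 3) (L := bf β * M) ρ β).map (starDecimation (bf β) M) = _
  exact map_starDecimation_wilsonMeasure_eq_pi ρ hρ (h2 β hβ) β

/-- **Clause (a) of `IRConjecture3` for the forest family, UNCONDITIONALLY**: on every tier-1 ball of track Y2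
(`ballOfRobustBallFR N ε₀ ε₁ r β⋆`, `ε₀, ε₁, β⋆ ≥ 0`), for the fundamental representation of `SU(N)`, every block
factor `2 ≤ b(β) ≤ C_b β` on `I`: `EntersClusterDomain` holds — with `β' = 0`, `W' = 0`. [folklore] -/
theorem entersClusterDomain_forestFamily_of_two_le {ε₀ ε₁ βstar C_b : ℝ} (h₀ : 0 ≤ ε₀) (h₁ : 0 ≤ ε₁)
    (hβ : 0 ≤ βstar) (rFR : ℕ) {b : ℝ → ℕ} (hb : ∀ β, 0 < b β) {I : Set ℝ} (h2 : ∀ β ∈ I, 2 ≤ b β)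
    (hfac : ∀ β ∈ I, (b β : ℝ) ≤ C_b * β) :
    EntersClusterDomain (ballOfRobustBallFR N ε₀ ε₁ rFR βstar) (fundamentalRep (Fin N)) (forestFamily b hb) I C_b :=
  entersClusterDomain_forestFamily h₀ h₁ hβ rFR
    (forestMarginalHaar_of_two_le _ (continuous_fundamentalRep (Fin N)) hb h2) hfac

/-- The SU(2), `d = 3` instance on the ball of the §Y4 sentence of record: clause (a) of its ONE conjecture holds for
the forest family with any block factor `2 ≤ b(β) ≤ C_b β` — no hypothesis on `β`, no dynamics. [folklore] -/
theorem su2_entersClusterDomain_forestFamily (r : ℕ) {b : ℝ → ℕ} (hb : ∀ β, 0 < b β) {I : Set ℝ} {C_b : ℝ}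
    (h2 : ∀ β ∈ I, 2 ≤ b β) (hfac : ∀ β ∈ I, (b β : ℝ) ≤ C_b * β) :
    EntersClusterDomain (ballOfRobustBallFR 2 (23 / 50) (23 / 100) r (1 / 16)) (fundamentalRep (Fin 2))
      (forestFamily b hb) I C_b :=
  entersClusterDomain_forestFamily_of_two_le (by norm_num) (by norm_num) (by norm_num) r hb h2 hfac

end ForestHaar

end Summit.Ventures.YMGap.YM3IR

end
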